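import Summits.QuantumAdvantage.QuantumAdvantage.Theorems.PerceptronDialLawsF

/-!
# PerceptronDialLaws — REV 8 additions (Theorems twin `PerceptronDialLaws.lean` 25c48419…, 2262 l; cell decomp-qadv, lens-3 g16 «PerceptronDial»; supports stmt-QuantumAdvantage-27984 LiftA).
The rev-7 twin is in the tree as `PerceptronDialLawsA/B/C/·/EA/E/F`; this delta carries, verbatim and in order, everything the refreshed twin ADDS after `end ChainRule`:
§15 `Restrict`/`SBlock` — the RESTRICTION LAW (T2) `rank_submatrix_le'`, `sBlock`, `rank_sBlock_le`, `MatrixLemma` from its `s×s` block; §16 `BlockProduct` — the BLOCK FORMULA (A)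
`sBlock_formula : sBlock (polM (gph P B c)) = Lz B + (xMat P B + (xMat P B)ᵀ)` (`polM_of_ev`, `Lz`, `c0P`, `sBlock_polM_c0`, `jm_castAdd`, `jqj_entry`) and the explicit MATRIX LEMMA
`XRankLemma` with `matrixLemma_of_xRankLemma`, `voteRung2_of_xRankLemma`, `xRankLemma_lowRange`.  As in parts E/F the closed `def … : Prop` statements are OPEN statements used only
as hypotheses of proved implications (critic 71v24) and are left untagged like the landed parts.  No `sorry`; standard axioms; no instances, no notation, no unsafe options.
-/


set_option linter.dupNamespace false

noncomputable section

namespace Summit.QuantumAdvantage.QuantumAdvantage.Theorems.PerceptronDial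

open Finset
open Literature.Computability.Complexity
open Literature.Computability.QuantumComplexity
open Literature.Computability.QuantumComplexity.BuzetChailloux (bxor zeroVec)
open Summit.QuantumAdvantage.QuantumAdvantage.Theses.AnfPresentation
  (AnfResidual RungA LiftA NearExactIsExact SignedExactSliceIsLift AnfEquiv)
open Summit.QuantumAdvantage.QuantumAdvantage.Theorems.HintDial
  (IsDualOf forrelation_eq_one_of_isDualOf flipConst value_flipConst rungA_of_anfResidual)
open Summit.QuantumAdvantage.QuantumAdvantage.Theorems.HintDial.Automaton
  (bd sgl mv MM blTable eval_blTable bd_sgl_left bd_bxor_right dualFn dualFn_append isDualOf_blTable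
    bit_bd bit_decide_and signOf_bd mv_bxor mv_eq_iff bxor_left_eq_iff' bd_zeroVec_right)
open Summit.QuantumAdvantage.QuantumAdvantage.Theorems.HintDial (bit_xor bit_and bit_not bit_eq_ite bit_decide_odd bit_injective bit_mul_self bit_false eval_bit)
open CubicForm (bit)
open DerivativeWalsh (W)
open Summit.QuantumAdvantage.QuantumAdvantage.Theorems.PebbleDial (AnfIdx bitsFG bits)

variable {n k : ℕ}

/-! ## §15 The RESTRICTION LAW (T2) in kernel: `rank (M|_{A×A'}) ≤ rank M`, and `MatrixLemma` from its `s×s`-block version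

(T2) of NODE-g16.md §4.8 — «`rank X ≥ rank X|_A` for every coordinate block» — as a generic kernel law over any field
(`rank_submatrix_le'`: arbitrary row AND column selections, via selection matrices and `Matrix.rank_mul_le_left/right`;
Mathlib's `Matrix.rank_submatrix_le` wants a column EQUIVALENCE), the `s×s` block `sBlock M := M.submatrix castAdd castAdd` of the
`2m×2m` polar matrix, and ★ `matrixLemma_of_sBlockLemma : SBlockLemma → MatrixLemma`, where `SBlockLemma` is `MatrixLemma` with
`rank polM(G_{P,B,c})` replaced by the rank of its `s×s` block — by the chain rule (§14) that block is `Ũ ⊕ (Jᵀ(q⊕qᵀ)J)|_{s×s}`, on paper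
(A) `= Ũ ⊕ S₀′ ⊕ ZŨ ⊕ ŨZᵀ ⊕ ŨΞŨ = X(Ũ)`: so `SBlockLemma` is §4.8's MATRIX LEMMA `E_Ũ 2^{−rank X(Ũ)/2} ≤ 200·2^{−m/32}` up to that one block
product (and the harmless floor `⌊m/32⌋`).  Kernel chain of W₂ after REV 8:
  `SBlockLemma → MatrixLemma → RankBound → RadBound → CoreBias → KeyBias → VoteRung2NU → VoteRung2`. -/

section Restrict

open scoped Matrix

variable {R : Type} [Field R]
variable {p q r s : Type} [Fintype q] [Fintype r] [DecidableEq q] [DecidableEq r]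

/-- a submatrix is a two-sided product with selection matrices -/
theorem submatrix_eq_sel_mul (A : Matrix q r R) (f : p → q) (g : s → r) :
    A.submatrix f g
      = (Matrix.of fun i k => if k = f i then (1 : R) else 0) * A * (Matrix.of fun k j => if k = g j then (1 : R) else 0) := by
  ext i j
  simp [Matrix.mul_apply, Matrix.of_apply]

/-- ★ (T2) RESTRICTION LAW: the rank of any block (arbitrary row and column selections) is at most the rank. -/
theorem rank_submatrix_le' [Fintype p] [Fintype s] (A : Matrix q r R) (f : p → q) (g : s → r) :
    (A.submatrix f g).rank ≤ A.rank := by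
  rw [submatrix_eq_sel_mul]
  exact (Matrix.rank_mul_le_left _ _).trans (Matrix.rank_mul_le_right _ _)

variable {m : ℕ}

/-- the `s×s` block of a `2m×2m` matrix indexed by `Fin (m+m)` (`s` = the first `m` coordinates, `castAdd`) -/
def sBlock (M : Matrix (Fin (m + m)) (Fin (m + m)) R) : Matrix (Fin m) (Fin m) R :=
  M.submatrix (Fin.castAdd m) (Fin.castAdd m)

/-- PerceptronDialLawsG helper `rank_sBlock_le` (decomp-qadv land package; see the module docstring). -/
theorem rank_sBlock_le (M : Matrix (Fin (m + m)) (Fin (m + m)) R) : (sBlock M).rank ≤ M.rank :=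
  rank_submatrix_le' M _ _

end Restrict

section SBlock

variable {m : ℕ}

/-- a Gauss term with a smaller rank exponent is larger: `2ⁿ/√(2^r) ≤ 2ⁿ/√(2^{r'})` for `r' ≤ r` -/
theorem gaussTerm_mono (n : ℕ) {r r' : ℕ} (h : r' ≤ r) :
    (2 : ℝ) ^ n / Real.sqrt ((2 : ℝ) ^ r) ≤ (2 : ℝ) ^ n / Real.sqrt ((2 : ℝ) ^ r') := by
  apply div_le_div_of_nonneg_left (by positivity) (by positivity)
  exact Real.sqrt_le_sqrt (pow_le_pow_right₀ (by norm_num) h)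

/-- ★★★ `SBlockLemma` — `MatrixLemma` for the `s×s` block: `∀ m ∀ P, 2^{⌊m/32⌋}·Σ_B Σ_c 2^{2m}/√(2^{rank (polM G_{P,B,c})|_{s×s}}) ≤ 200·|QParam m|`.
By §14 the block is `Ũ ⊕ (Jᵀ(q⊕qᵀ)J)|_{s×s}` (`= X(Ũ)` of NODE-g16.md §4.8(A) after one block product), so this IS the paper's MATRIX LEMMA
`E_Ũ 2^{−rank X(Ũ)/2} ≤ 200·2^{−m/32}` at the kernel interface.  [UNDECIDED in kernel · PAPER-PROVED (§4.8 (T1),(B′),(B″)) · ATTACKABLE (M–L)] -/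
def SBlockLemma : Prop := ∀ m : ℕ, ∀ P : QuadP (CVar m),
  (2 : ℝ) ^ (m / 32) * ∑ B : Fin m → Fin m → Bool, ∑ c : Bool,
      (2 : ℝ) ^ (m + m) / Real.sqrt ((2 : ℝ) ^ (sBlock (polM (gph P B c))).rank) ≤ 200 * (Fintype.card (QParam m) : ℝ)

/-- ★★ [kernel, (T2)] `SBlockLemma → MatrixLemma` (termwise: `rank M ≥ rank M|_{s×s}`). -/
theorem matrixLemma_of_sBlockLemma : SBlockLemma → MatrixLemma := by
  intro h m P
  refine le_trans ?_ (h m P)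
  apply mul_le_mul_of_nonneg_left _ (by positivity)
  exact Finset.sum_le_sum fun B _ => Finset.sum_le_sum fun c _ => gaussTerm_mono _ (rank_sBlock_le _)

/-- PerceptronDialLawsG helper `voteRung2_of_sBlockLemma` (decomp-qadv land package; see the module docstring). -/
theorem voteRung2_of_sBlockLemma : SBlockLemma → VoteRung2 :=
  fun h => voteRung2_of_matrixLemma (matrixLemma_of_sBlockLemma h)

/-- the `s×s` block made explicit by the chain rule: `(polM G)|_{s×s} = (polM c₀_B)|_{s×s} + (JᵀqJ + (JᵀqJ)ᵀ)|_{s×s}` -/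
theorem sBlock_polM_gph (P : QuadP (CVar m)) (B : Fin m → Fin m → Bool) (c : Bool) :
    sBlock (polM (gph P B c))
      = sBlock (polM (c0 B)) + sBlock ((jm B c).transpose * Matrix.of P.q * jm B c
          + ((jm B c).transpose * Matrix.of P.q * jm B c).transpose) := by
  rw [polM_gph]; rfl

end SBlock

/-! ## §16 The BLOCK PRODUCT (A) in kernel: `(polM G_{P,B,c})|_{s×s} = Ũ ⊕ X ⊕ Xᵀ`, `X = S + Z·Ũ + Ũᵀ·Z′ + Ũᵀ·Ξ·Ũ`

The remaining half of (A) of NODE-g16.md §4.8: with `Ũ = Lz B` (the `𝔽₂` polar matrix `U_B + U_Bᵀ` of the key form), the `s×s` block of the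
face's own polar matrix is `Ũ` (`sBlock_polM_c0`, via the general `polM_of_ev : polM (Q) = q + qᵀ` for `bit ∘ Q = P.ev`), the `s`-columns of the
Jacobian are `J|_s = E_s + E_p·Ũ` (`js_eq`; `E_s`, `E_p` the coordinate selections `sel vs`, `sel vp`), hence
`(Jᵀ q J)|_{s×s} = q_ss + q_sp·Ũ + Ũᵀ·q_ps + Ũᵀ·q_pp·Ũ =: X_{P,B}` (`sBlock_jqj`; `q_xy` = the blocks of the coefficient table `P.q`) and
★★ `sBlock_formula : sBlock (polM (gph P B c)) = Lz B + (xMat P B + (xMat P B)ᵀ)` — the paper's `X(Ũ) = Ũ ⊕ S₀′ ⊕ ZŨ ⊕ ŨZᵀ ⊕ ŨΞŨ` with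
`S₀′ = q_ss ⊕ q_ssᵀ`, `Z = q_sp ⊕ q_psᵀ`, `Ξ = q_pp ⊕ q_ppᵀ` (`Ũ` symmetric).  So (A) is now ENTIRELY kernel, and the prose/kernel boundary of W₂ is
★★★ `XRankLemma` — the paper's MATRIX LEMMA verbatim: `∀ m ∀ P, 2^{⌊m/32⌋}·Σ_B 2·2^{2m}/√(2^{rank(Ũ_B ⊕ X_{P,B} ⊕ X_{P,B}ᵀ)}) ≤ 200·|QParam m|` — with
★ `matrixLemma_of_xRankLemma : XRankLemma → MatrixLemma` ((T2) `rank_sBlock_le` + `sBlock_formula` + `c`-freeness).  Kernel chain of W₂ (REV 8):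
  `XRankLemma → MatrixLemma → RankBound → RadBound → CoreBias → KeyBias → VoteRung2NU → VoteRung2`;
left on paper: (T1) corank tail, Lemma S̄ (B′), isotropic complement (B″) — all about the explicit `m×m` matrix `Ũ ⊕ X ⊕ Xᵀ` over uniform symmetric zero-diagonal `Ũ`. -/

section BlockProduct

open scoped Matrix
open CVar

variable {m : ℕ}

/-- `polM` of a function whose bits are a `QuadP` evaluation is `q + qᵀ` (the diagonal is `2q_ii = 0`) -/
theorem polM_of_ev (Q : (Fin n → Bool) → Bool) (P : QuadP (Fin n)) (hQ : ∀ x, bit (Q x) = P.ev x) (i j : Fin n) :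
    polM Q i j = P.q i j + P.q j i := by
  rw [polM_apply, bit_diff2_eq_dZ]
  have e : (fun x => bit (Q x)) = fun x => P.ev ((fun (x : Fin n → Bool) (u : Fin n) => x u) x) := funext hQ
  rw [e, dZ_ev_aff P (fun x u => x u) (fun u => isAffZ_coord u)]
  have hj : ∀ k u : Fin n, jac (fun (x : Fin n → Bool) (u : Fin n) => x u) (ofZ (Pi.single k 1)) u
      = if u = k then 1 else 0 := fun k u => by
    show bit (unbit (Pi.single (M := fun _ => ZMod 2) k (1 : ZMod 2) u)) + bit (zeroVec u) = _
    rw [bit_unbit, Pi.single_apply]; simp [zeroVec]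
  have key : ∀ u, ∑ v, P.q u v * (jac (fun (x : Fin n → Bool) (u : Fin n) => x u) (ofZ (Pi.single j 1)) u
        * jac (fun (x : Fin n → Bool) (u : Fin n) => x u) (ofZ (Pi.single i 1)) v
      + jac (fun (x : Fin n → Bool) (u : Fin n) => x u) (ofZ (Pi.single i 1)) u
        * jac (fun (x : Fin n → Bool) (u : Fin n) => x u) (ofZ (Pi.single j 1)) v)
      = (if u = j then P.q u i else 0) + (if u = i then P.q u j else 0) := fun u => by
    simp only [hj, mul_add, Finset.sum_add_distrib]
    congr 1 <;> (split_ifs <;> simp [Finset.sum_ite_eq', mul_ite])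
  rw [Finset.sum_congr rfl fun u _ => key u]
  simp only [Finset.sum_add_distrib, Finset.sum_ite_eq', Finset.mem_univ, if_true]
  rw [add_comm]

/-- ★ the polar matrix `Ũ = U_B + U_Bᵀ` of the key form `Q_B`, over `𝔽₂` (symmetric, zero diagonal) -/
def Lz (B : Fin m → Fin m → Bool) : Matrix (Fin m) (Fin m) (ZMod 2) := fun a a' => bit (ut B a a') + bit (ut B a' a)

/-- PerceptronDialLawsG helper `Lz_transpose` (decomp-qadv land package; see the module docstring). -/
theorem Lz_transpose (B : Fin m → Fin m → Bool) : (Lz B)ᵀ = Lz B := by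
  ext a a'; show bit _ + bit _ = bit _ + bit _; rw [add_comm]

/-- PerceptronDialLawsG helper `bit_polar` (decomp-qadv land package; see the module docstring). -/
theorem bit_polar (B : Fin m → Fin m → Bool) (s : Fin m → Bool) (a : Fin m) :
    bit (polar B s a) = ∑ a', Lz B a a' * bit (s a') := by
  show bit (xor (bd (ut B a) s) (bd (tr (ut B) a) s)) = _
  simp only [bit_xor, bit_bd, tr, Lz, add_mul, sum_add_distrib]

/-- the face's own phase `c₀_B = ⟨t,s⟩ ⊕ Q_B(s)` as a `QuadP` over the `2m` input coordinates -/
def c0P (B : Fin m → Fin m → Bool) : QuadP (Fin (m + m)) where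
  c := 0
  l := fun _ => 0
  q := fun i j => Fin.addCases
    (fun a : Fin m => Fin.addCases (fun a' : Fin m => bit (ut B a a')) (fun _ => 0) j)
    (fun a : Fin m => Fin.addCases (fun a' : Fin m => if a = a' then 1 else 0) (fun _ => 0) j) i

/-- PerceptronDialLawsG helper `c0P_c` (decomp-qadv land package; see the module docstring). -/
theorem c0P_c (B : Fin m → Fin m → Bool) : (c0P B).c = 0 := rfl

/-- PerceptronDialLawsG helper `c0P_l` (decomp-qadv land package; see the module docstring). -/
theorem c0P_l (B : Fin m → Fin m → Bool) (i : Fin (m + m)) : (c0P B).l i = 0 := rfl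

/-- PerceptronDialLawsG helper `c0P_q_ss` (decomp-qadv land package; see the module docstring). -/
theorem c0P_q_ss (B : Fin m → Fin m → Bool) (a a' : Fin m) :
    (c0P B).q (Fin.castAdd m a) (Fin.castAdd m a') = bit (ut B a a') := by
  simp only [c0P, Fin.addCases_left]

/-- PerceptronDialLawsG helper `c0P_q_ts` (decomp-qadv land package; see the module docstring). -/
theorem c0P_q_ts (B : Fin m → Fin m → Bool) (a a' : Fin m) :
    (c0P B).q (Fin.natAdd m a) (Fin.castAdd m a') = if a = a' then 1 else 0 := by
  simp only [c0P, Fin.addCases_left, Fin.addCases_right]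

/-- PerceptronDialLawsG helper `c0P_q_st` (decomp-qadv land package; see the module docstring). -/
theorem c0P_q_st (B : Fin m → Fin m → Bool) (a a' : Fin m) :
    (c0P B).q (Fin.castAdd m a) (Fin.natAdd m a') = 0 := by
  simp only [c0P, Fin.addCases_left, Fin.addCases_right]

/-- PerceptronDialLawsG helper `c0P_q_tt` (decomp-qadv land package; see the module docstring). -/
theorem c0P_q_tt (B : Fin m → Fin m → Bool) (a a' : Fin m) :
    (c0P B).q (Fin.natAdd m a) (Fin.natAdd m a') = 0 := by
  simp only [c0P, Fin.addCases_right]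

/-- PerceptronDialLawsG helper `bit_c0_eq_ev` (decomp-qadv land package; see the module docstring). -/
theorem bit_c0_eq_ev (B : Fin m → Fin m → Bool) (x : Fin (m + m) → Bool) : bit (c0 B x) = (c0P B).ev x := by
  rw [c0, bit_xor, bit_bd, bit_qf]
  simp only [QuadP.ev, Fin.sum_univ_add, c0P_q_ss, c0P_q_ts, c0P_q_st, c0P_q_tt, c0P_c, c0P_l, zero_mul,
    sum_const_zero, add_zero, zero_add, ite_mul, one_mul, Finset.sum_ite_eq, Finset.mem_univ, if_true]
  rw [add_comm]
  rfl

/-- ★ the `s×s` block of the face's own polar matrix is `Ũ` -/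
theorem sBlock_polM_c0 (B : Fin m → Fin m → Bool) : sBlock (polM (c0 B)) = Lz B := by
  ext a a'
  show polM (c0 B) (Fin.castAdd m a) (Fin.castAdd m a') = _
  rw [polM_of_ev (c0 B) (c0P B) (bit_c0_eq_ev B), c0P_q_ss, c0P_q_ss]; rfl

/-- (the other blocks, for the record: `⟨t,s⟩` contributes identity off-diagonal blocks and nothing else) -/
theorem polM_c0_ts (B : Fin m → Fin m → Bool) (a a' : Fin m) :
    polM (c0 B) (Fin.natAdd m a) (Fin.castAdd m a') = if a = a' then 1 else 0 := by
  rw [polM_of_ev (c0 B) (c0P B) (bit_c0_eq_ev B), c0P_q_ts, c0P_q_st, add_zero]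

/-- PerceptronDialLawsG helper `polM_c0_tt` (decomp-qadv land package; see the module docstring). -/
theorem polM_c0_tt (B : Fin m → Fin m → Bool) (a a' : Fin m) :
    polM (c0 B) (Fin.natAdd m a) (Fin.natAdd m a') = 0 := by
  rw [polM_of_ev (c0 B) (c0P B) (bit_c0_eq_ev B), c0P_q_tt, c0P_q_tt, add_zero]

/-- the `s`-part of a standard basis vector of `𝔽₂^{2m}` read back as a Boolean vector -/
theorem bit_sOf_ofZ_single_castAdd (b a' : Fin m) :
    bit (sOf (ofZ (Pi.single (M := fun _ => ZMod 2) (Fin.castAdd m b) 1)) a') = if a' = b then 1 else 0 := by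
  show bit (unbit (Pi.single (M := fun _ => ZMod 2) (Fin.castAdd m b) (1 : ZMod 2) (Fin.castAdd m a'))) = _
  rw [bit_unbit, Pi.single_apply]
  simp [Fin.ext_iff]

/-- ★ the `s`-columns of the Jacobian, explicitly: `J|_s = E_s + E_p·Ũ` — rows `vs a' ↦ [a' = b]`, `vp a' ↦ Ũ_{a'b}`, all other rows `0` -/
def js (B : Fin m → Fin m → Bool) (u : CVar m) (b : Fin m) : ZMod 2 :=
  match u with
  | Sum.inl a' => if a' = b then 1 else 0
  | Sum.inr (Sum.inl _) => 0
  | Sum.inr (Sum.inr (Sum.inl _)) => 0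
  | Sum.inr (Sum.inr (Sum.inr (Sum.inl a'))) => Lz B a' b
  | Sum.inr (Sum.inr (Sum.inr (Sum.inr _))) => 0

/-- PerceptronDialLawsG helper `js_s` (decomp-qadv land package; see the module docstring). -/
theorem js_s (B : Fin m → Fin m → Bool) (a' b : Fin m) : js B (Sum.inl a') b = if a' = b then 1 else 0 := rfl
/-- PerceptronDialLawsG helper `js_t` (decomp-qadv land package; see the module docstring). -/
theorem js_t (B : Fin m → Fin m → Bool) (a' b : Fin m) : js B (Sum.inr (Sum.inl a')) b = 0 := rfl
/-- PerceptronDialLawsG helper `js_B` (decomp-qadv land package; see the module docstring). -/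
theorem js_B (B : Fin m → Fin m → Bool) (aa : Fin m × Fin m) (b : Fin m) : js B (Sum.inr (Sum.inr (Sum.inl aa))) b = 0 := rfl
/-- PerceptronDialLawsG helper `js_p` (decomp-qadv land package; see the module docstring). -/
theorem js_p (B : Fin m → Fin m → Bool) (a' b : Fin m) : js B (Sum.inr (Sum.inr (Sum.inr (Sum.inl a')))) b = Lz B a' b := rfl
/-- PerceptronDialLawsG helper `js_c` (decomp-qadv land package; see the module docstring). -/
theorem js_c (B : Fin m → Fin m → Bool) (u : Unit) (b : Fin m) : js B (Sum.inr (Sum.inr (Sum.inr (Sum.inr u)))) b = 0 := rfl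

/-- PerceptronDialLawsG helper `jm_castAdd` (decomp-qadv land package; see the module docstring). -/
theorem jm_castAdd (B : Fin m → Fin m → Bool) (c : Bool) (u : CVar m) (b : Fin m) :
    jm B c u (Fin.castAdd m b) = js B u b := by
  rcases u with a | a | ⟨a, a'⟩ | a | u
  · show jm B c (vs a) _ = _
    rw [jm_vs, Pi.single_apply, js_s]
    simp [Fin.ext_iff, eq_comm]
  · show jm B c (vt a) _ = _
    rw [jm_vt, Pi.single_apply, js_t]
    simp [Fin.ext_iff]
    omega
  · show jm B c (vB a a') _ = _
    rw [jm_vB]; rfl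
  · show jm B c (vp a) _ = _
    rw [jm_vp, bit_polar, js_p]
    simp only [bit_sOf_ofZ_single_castAdd, mul_ite, mul_one, mul_zero, Finset.sum_ite_eq', Finset.mem_univ, if_true]
  · show jm B c vc _ = _
    rw [jm_vc]; rfl

/-- a row sum against the explicit `s`-columns: `Σ_u g(u)·J_{u,s_a} = g(s_a) + Σ_{a'} g(p_{a'})·Ũ_{a'a}` -/
theorem rowsum_js (B : Fin m → Fin m → Bool) (g : CVar m → ZMod 2) (a : Fin m) :
    ∑ u, g u * js B u a = g (vs a) + ∑ a', g (vp a') * Lz B a' a := by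
  simp only [Fintype.sum_sum_type, js_s, js_t, js_B, js_p, js_c, mul_zero, sum_const_zero, add_zero, zero_add,
    mul_ite, mul_one, Finset.sum_ite_eq', Finset.mem_univ, if_true]

/-- the blocks of the coefficient table `q` of `P` along the `s`- and `p`-coordinates -/
def qss (P : QuadP (CVar m)) : Matrix (Fin m) (Fin m) (ZMod 2) := fun a b => P.q (vs a) (vs b)
/-- PerceptronDialLawsG helper `qsp` (decomp-qadv land package; see the module docstring). -/
def qsp (P : QuadP (CVar m)) : Matrix (Fin m) (Fin m) (ZMod 2) := fun a b => P.q (vs a) (vp b)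
/-- PerceptronDialLawsG helper `qps` (decomp-qadv land package; see the module docstring). -/
def qps (P : QuadP (CVar m)) : Matrix (Fin m) (Fin m) (ZMod 2) := fun a b => P.q (vp a) (vs b)
/-- PerceptronDialLawsG helper `qpp` (decomp-qadv land package; see the module docstring). -/
def qpp (P : QuadP (CVar m)) : Matrix (Fin m) (Fin m) (ZMod 2) := fun a b => P.q (vp a) (vp b)

/-- ★ `X_{P,B} := q_ss + q_sp·Ũ + Ũᵀ·q_ps + Ũᵀ·q_pp·Ũ` (all `m×m` over `𝔽₂`) -/
def xMat (P : QuadP (CVar m)) (B : Fin m → Fin m → Bool) : Matrix (Fin m) (Fin m) (ZMod 2) :=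
  qss P + qsp P * Lz B + (Lz B)ᵀ * qps P + (Lz B)ᵀ * qpp P * Lz B

/-- ★★ the BLOCK PRODUCT, entrywise: `Σ_{u,v} q_{uv} J_{u,s_a} J_{v,s_b} = (X_{P,B})_{ab}` -/
theorem jqj_entry (P : QuadP (CVar m)) (B : Fin m → Fin m → Bool) (c : Bool) (a b : Fin m) :
    ∑ u, ∑ v, P.q u v * (jm B c u (Fin.castAdd m a) * jm B c v (Fin.castAdd m b)) = xMat P B a b := by
  simp only [jm_castAdd]
  have h1 : ∀ u, ∑ v, P.q u v * (js B u a * js B v b) = (P.q u (vs b) + ∑ b', P.q u (vp b') * Lz B b' b) * js B u a :=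
    fun u => by
      rw [← rowsum_js B (P.q u) b, sum_mul]
      exact sum_congr rfl fun v _ => by ring
  rw [Finset.sum_congr rfl fun u _ => h1 u, rowsum_js B (fun u => P.q u (vs b) + ∑ b', P.q u (vp b') * Lz B b' b) a]
  simp only [xMat, Matrix.add_apply, Matrix.mul_apply, Matrix.transpose_apply, qss, qsp, qps, qpp, add_mul, sum_add_distrib,
    sum_mul]
  have e4 : ∑ a', ∑ b', P.q (vp a') (vp b') * Lz B b' b * Lz B a' a
      = ∑ x, ∑ y, Lz B y a * P.q (vp y) (vp x) * Lz B x b := by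
    rw [sum_comm]
    exact sum_congr rfl fun b' _ => sum_congr rfl fun a' _ => by ring
  rw [e4]
  have e3 : ∑ a', P.q (vp a') (vs b) * Lz B a' a = ∑ x, Lz B x a * P.q (vp x) (vs b) :=
    sum_congr rfl fun a' _ => by ring
  rw [e3]
  abel

/-- PerceptronDialLawsG helper `sBlock_add` (decomp-qadv land package; see the module docstring). -/
theorem sBlock_add (M N : Matrix (Fin (m + m)) (Fin (m + m)) (ZMod 2)) : sBlock (M + N) = sBlock M + sBlock N := rfl
/-- PerceptronDialLawsG helper `sBlock_transpose` (decomp-qadv land package; see the module docstring). -/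
theorem sBlock_transpose (M : Matrix (Fin (m + m)) (Fin (m + m)) (ZMod 2)) : sBlock Mᵀ = (sBlock M)ᵀ := rfl

/-- ★★★ (A) IN KERNEL: `(polM G_{P,B,c})|_{s×s} = Ũ_B + X_{P,B} + X_{P,B}ᵀ` — the paper's `X(Ũ) = Ũ ⊕ S₀′ ⊕ ZŨ ⊕ ŨZᵀ ⊕ ŨΞŨ`
(`S₀′ = q_ss ⊕ q_ssᵀ`, `Z = q_sp ⊕ q_psᵀ`, `Ξ = q_pp ⊕ q_ppᵀ`, `Ũ` symmetric). -/
theorem sBlock_formula (P : QuadP (CVar m)) (B : Fin m → Fin m → Bool) (c : Bool) :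
    sBlock (polM (gph P B c)) = Lz B + (xMat P B + (xMat P B)ᵀ) := by
  ext a b
  show polM (gph P B c) (Fin.castAdd m a) (Fin.castAdd m b) = Lz B a b + (xMat P B a b + xMat P B b a)
  rw [polM_gph_apply, ← sBlock_polM_c0 B]
  show sBlock (polM (c0 B)) a b + _ = _
  congr 1
  rw [← jqj_entry P B c a b, ← jqj_entry P B c b a, ← sum_add_distrib]
  refine sum_congr rfl fun u _ => ?_
  rw [← sum_add_distrib]
  exact sum_congr rfl fun v _ => by ring

/-- ★★★ `XRankLemma` — THE MATRIX LEMMA of NODE-g16.md §4.8 VERBATIM at the kernel boundary: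
`∀ m ∀ P, 2^{⌊m/32⌋} · Σ_B 2·2^{2m}/√(2^{rank(Ũ_B + X_{P,B} + X_{P,B}ᵀ)}) ≤ 200·|QParam m|`, i.e. `E_Ũ 2^{−rank X(Ũ)/2} ≤ 200·2^{−m/32}` for the
`S₀′, Z, Ξ` read off `P` and `Ũ` uniform symmetric zero-diagonal.  [UNDECIDED in kernel · PAPER-PROVED §4.8 ((T1) corank tail, (B′) Lemma S̄,
(B″) isotropic complement) · ATTACKABLE (M–L: linear algebra and counting over `𝔽₂`; no complexity object, no `p`, no face)] -/
def XRankLemma : Prop := ∀ m : ℕ, ∀ P : QuadP (CVar m),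
  (2 : ℝ) ^ (m / 32) * ∑ B : Fin m → Fin m → Bool,
      2 * ((2 : ℝ) ^ (m + m) / Real.sqrt ((2 : ℝ) ^ (Lz B + (xMat P B + (xMat P B)ᵀ)).rank)) ≤ 200 * (Fintype.card (QParam m) : ℝ)

/-- ★★ [kernel: (A) `sBlock_formula` + (T2) `rank_sBlock_le` + `c`-freeness] `XRankLemma → MatrixLemma`. -/
theorem matrixLemma_of_xRankLemma : XRankLemma → MatrixLemma := by
  intro h m P
  refine le_trans ?_ (h m P)
  apply mul_le_mul_of_nonneg_left _ (by positivity)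
  refine Finset.sum_le_sum fun B _ => ?_
  rw [Fintype.sum_bool, two_mul]
  apply add_le_add
  · rw [← sBlock_formula P B true]
    exact gaussTerm_mono _ (rank_sBlock_le _)
  · rw [← sBlock_formula P B false]
    exact gaussTerm_mono _ (rank_sBlock_le _)

/-- PerceptronDialLawsG helper `rankBound_of_xRankLemma` (decomp-qadv land package; see the module docstring). -/
theorem rankBound_of_xRankLemma : XRankLemma → RankBound :=
  fun h => rankBound_of_matrixLemma (matrixLemma_of_xRankLemma h)

/-- PerceptronDialLawsG helper `coreBias_of_xRankLemma` (decomp-qadv land package; see the module docstring). -/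
theorem coreBias_of_xRankLemma : XRankLemma → CoreBias :=
  fun h => coreBias_of_matrixLemma (matrixLemma_of_xRankLemma h)

/-- ★★ W₂'s whole kernel chain from the explicit matrix lemma: `XRankLemma → VoteRung2`. -/
theorem voteRung2_of_xRankLemma : XRankLemma → VoteRung2 :=
  fun h => voteRung2_of_matrixLemma (matrixLemma_of_xRankLemma h)

/-- PerceptronDialLawsG helper `gaussTerm_le'` (decomp-qadv land package; see the module docstring). -/
theorem gaussTerm_le' (n r : ℕ) : (2 : ℝ) ^ n / Real.sqrt ((2 : ℝ) ^ r) ≤ (2 : ℝ) ^ n := by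
  apply div_le_self (by positivity)
  rw [← Real.sqrt_one]
  exact Real.sqrt_le_sqrt (one_le_pow₀ (by norm_num))

/-- calibration (kernel): `XRankLemma` holds outright in the low range `m < 256` (`2^{⌊m/32⌋} ≤ 128 ≤ 200`, `E ≤ 1`); its content is the decay. -/
theorem xRankLemma_lowRange (m : ℕ) (hm : m < 256) (P : QuadP (CVar m)) :
    (2 : ℝ) ^ (m / 32) * ∑ B : Fin m → Fin m → Bool,
      2 * ((2 : ℝ) ^ (m + m) / Real.sqrt ((2 : ℝ) ^ (Lz B + (xMat P B + (xMat P B)ᵀ)).rank)) ≤ 200 * (Fintype.card (QParam m) : ℝ) := by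
  have h1 : (2 : ℝ) ^ (m / 32) ≤ (2 : ℝ) ^ 7 := pow_le_pow_right₀ (by norm_num) (by omega)
  have hBc : Fintype.card (Fin m → Fin m → Bool) = 2 ^ (m * m) := by
    rw [Fintype.card_fun, Fintype.card_fun, Fintype.card_bool, Fintype.card_fin, ← pow_mul]
  have h2 : ∑ B : Fin m → Fin m → Bool,
      2 * ((2 : ℝ) ^ (m + m) / Real.sqrt ((2 : ℝ) ^ (Lz B + (xMat P B + (xMat P B)ᵀ)).rank))
        ≤ (Fintype.card (QParam m) : ℝ) := by
    calc ∑ B : Fin m → Fin m → Bool, 2 * ((2 : ℝ) ^ (m + m) / Real.sqrt ((2 : ℝ) ^ (Lz B + (xMat P B + (xMat P B)ᵀ)).rank))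
        ≤ ∑ B : Fin m → Fin m → Bool, 2 * (2 : ℝ) ^ (m + m) :=
          Finset.sum_le_sum fun B _ => mul_le_mul_of_nonneg_left (gaussTerm_le' _ _) (by norm_num)
      _ = (Fintype.card (QParam m) : ℝ) := by
          simp only [Finset.sum_const, Finset.card_univ, nsmul_eq_mul, hBc, card_QParam]
          push_cast
          ring
  have h0 : (0 : ℝ) ≤ ∑ B : Fin m → Fin m → Bool,
      2 * ((2 : ℝ) ^ (m + m) / Real.sqrt ((2 : ℝ) ^ (Lz B + (xMat P B + (xMat P B)ᵀ)).rank)) :=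
    Finset.sum_nonneg fun B _ => by positivity
  calc _ ≤ (2 : ℝ) ^ 7 * (Fintype.card (QParam m) : ℝ) := mul_le_mul h1 h2 h0 (by positivity)
    _ ≤ _ := mul_le_mul_of_nonneg_right (by norm_num) (by positivity)

end BlockProduct

end Summit.QuantumAdvantage.QuantumAdvantage.Theorems.PerceptronDial
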